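import Summits.BirchSwinnertonDyer.BirchSwinnertonDyer.Theorems.GenusKolyvaginAtTwoK4NegPhantomCellHalvingBit
import Summits.BirchSwinnertonDyer.BirchSwinnertonDyer.Theorems.GenusKolyvaginAtTwoLeafCensusWallResidual
import Summits.BirchSwinnertonDyer.BirchSwinnertonDyer.Theses.ByReductionTypeAtTwo
import Literature.NumberTheory.EllipticCurves.HeegnerPointsKolyvaginExceptionalTwistProofs
import HarnessLib

/-!
# Route `GenusKolyvaginAtTwo`, crux K₄⁻ `K4Neg` (stmt-BirchSwinnertonDyer-31526) — K4Neg AT EVERY FRAME ⟸ WALL row 1 + U₂ + Q2 + PRINT + the halving bit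

LEAD seat `bsd-line-gk2-p1` g28, `--supports stmt-BirchSwinnertonDyer-31526 --as helper`.  THEOREMS ONLY; no `sorry`.  **BSD is NOT proved here;
K4Neg is NOT proved; nothing is closed.**  The by-name form of `…K4NegPhantomCellHalvingBit` for the route pen: the binders of the route item
`K4Neg` VERBATIM (including the ones this road does not use: the cut-free `#Sel₂(E) = 4`, the prime `ℓ₀`, the `2`-splitting, the optimality
clause), then the four WALL rows of `ByReductionTypeAtTwo` (items 19095–19098), U₂ `MinimalTwinBSDTwo` (22985), Q2 `KolyvaginRelationAtTwo`
(24880) and the four PRINT items BY NAME, and the ONE residual bit `hHalf` («a `K`-rational point halvable by a `Γ_{K(E[4])}`-fixed point is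
halvable in `E(K)`»), conclude K4Neg's conclusion at the frame — on the cut, off the cut, multiplicative or not at `2`: the phantom cell F4ᵖᵍ
included.  `BSD₂(E)` is WALL row 1 (`Census.bsdp_rankZero_of_wallRows`), `BSD₂(Wd)` is U₂ (the twin is non-CM, `r_an = 1`, `#Sel₂ = 2`).  So,
as an INTER-ROUTE CENSUS statement (director (644)(a)/(657)), **K4Neg ⟸ WALL row 1 ∧ U₂ ∧ Q2 ∧ PRINT ∧ (hHalf on its frames)**.
References: [McCallumLMS1991] §5; [Kolyvagin1989Izv] Thm. B₂; [LawsonWuthrich2016] §7.1; [Miller2011LMS] Def. 1.1; [SilvermanAEC2009] X.4.14.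
-/

set_option autoImplicit false
-- the Theorems namespace of this sub repeats the summit name by design (D-0017 nested layout)
set_option linter.dupNamespace false

noncomputable section

open scoped Classical

namespace Summit.BirchSwinnertonDyer.BirchSwinnertonDyer.Theorems.GenusExact.PlusDescent

open WeierstrassCurve NumberField IsDedekindDomain Field Literature.NumberTheory.EllipticCurves
  Literature.NumberTheory.GaloisRepresentations Literature.NumberTheory.EllipticCurves.ModularForms
  Literature.NumberTheory.EllipticCurves.RingClassField
open Summit.BirchSwinnertonDyer.BirchSwinnertonDyer.Theses.GenusKolyvaginAtTwo
  (KolyvaginRelationAtTwo GrossZagierAllLevels MultPublishedInputsAtTwo EntireLFunctionRat MilneAnyModel MinimalTwinBSDTwo)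
open Summit.BirchSwinnertonDyer.BirchSwinnertonDyer.Theses.ByReductionTypeAtTwo
  (GoodOrdinaryRankZeroAtTwo MultiplicativeRankZeroAtTwo SupersingularRankZeroAtTwo AdditiveRankZeroAtTwo)
open Summit.BirchSwinnertonDyer.BirchSwinnertonDyer.Theorems.GenusExact

/-- **K4Neg AT A FRAME ⟸ WALL row 1 + U₂ + Q2 + PRINT + `hHalf`** (binders of the route item `K4Neg` verbatim, then the route items by name, then
the halving bit).  `BSD₂(E)` from the WALL rows (`Census.bsdp_rankZero_of_wallRows`), `BSD₂(Wd)` from U₂ (twin non-CM by `j`-invariance,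
`not_hasCM_quadraticTwist` / `not_hasCM_variableChange`), then `kFourNeg_conclusion_of_bsdp_pair_of_halvingBit`.  CONDITIONAL on OPEN route items
and on `hHalf`; BSD is NOT proved; K4Neg is NOT proved. [cite: Miller2011LMS, Def. 1.1] [cite: McCallumLMS1991, §5 Thm. 5.4]
[cite: LawsonWuthrich2016, §7.1] [cite: SilvermanAEC2009, Thm. X.4.14] -/
theorem kFourNeg_conclusion_of_wallRows_U2_of_halvingBit (hOrd : GoodOrdinaryRankZeroAtTwo) (hMult : MultiplicativeRankZeroAtTwo)
    (hSS : SupersingularRankZeroAtTwo) (hAdd : AdditiveRankZeroAtTwo) (hTw : MinimalTwinBSDTwo) (hQ2 : KolyvaginRelationAtTwo)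
    (hGZ : GrossZagierAllLevels) (hGZK : MultPublishedInputsAtTwo) (hL : EntireLFunctionRat) (hMi : MilneAnyModel)
    (W : WeierstrassCurve ℚ) [W.IsElliptic] [W.IsGloballyMinimal] [NeZero (W.conductorNorm ℤ)]
    (hcm : ¬ W.HasCM) (hr0 : W.analyticRank = 0) (hρ : ∀ n : ℕ, 0 < n → W.HasSurjectiveModNGaloisRep ((2 : ℤ) ^ n))
    (hT : Odd W.tamagawaProduct) (hneg : W.Δ < 0) (_h4 : Nat.card (W.selmerGroup 2) = 4)
    (K : Type) [Field K] [NumberField K] (hIQ : IsImaginaryQuadratic K) (hodd : Odd (NumberField.discr K))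
    (h3 : NumberField.discr K ≠ -3) (hHe : SatisfiesHeegnerHypothesis (W.conductorNorm ℤ) K)
    (hsq1 : ¬ IsSquare ((NumberField.discr K : ℚ) * -|W.Δ|)) (hsq2 : ¬ IsSquare ((NumberField.discr K : ℚ) * (-(2 * |W.Δ|))))
    (_ℓ₀ : ℕ) (_hℓ₀ : _ℓ₀.Prime) (_hdK : NumberField.discr K = -(_ℓ₀ : ℤ))
    (_h2K : ((Ideal.span {(2 : ℤ)}).primesOver (𝓞 K)).ncard = 2)
    (Dt : ModularParametrizationData W (W.conductorNorm ℤ))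
    (_hopt : ∀ z ∈ Dt.L.lattice, ∃ w ∈ periodLattice Dt.f, z = (Dt.c : ℂ) * w) (hc : Odd Dt.c)
    (β : ℤ) (ι : K →+* ℂ) (d₁ : KolyvaginHeegnerData Dt β ι 1) (hy : ¬ IsOfFinAddOrder d₁.derivedPoint)
    (M₀ : ℕ) (hdiv : ∃ Q : (W.baseChange (ringClassField K ι 1)).toAffine.Point, ((2 ^ M₀ : ℕ) : ℤ) • Q = d₁.derivedPoint)
    (hndiv : ¬ ∃ Q : (W.baseChange (ringClassField K ι 1)).toAffine.Point, ((2 ^ (M₀ + 1) : ℕ) : ℤ) • Q = d₁.derivedPoint)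
    (hM₀ : 1 ≤ M₀)
    (Wd : WeierstrassCurve ℚ) [Wd.IsElliptic] [Wd.IsGloballyMinimal]
    (hWd : ∃ C : VariableChange ℚ, C • W.quadraticTwist (NumberField.discr K : ℚ) = Wd)
    (hrd : Wd.analyticRank = 1) (hSel : Nat.card (Wd.selmerGroup 2) = 2) (hDEF : padicValNat 2 Wd.tamagawaProduct ≤ 1)
    (hHalf : ∀ (R : (W.baseChange K).toAffine.Point) (Q : geomPoints (W.baseChange K)),
      (∀ ρ ∈ torsionFixing (W.baseChange K) (4 : ℤ), ρ • Q = Q) → (2 : ℤ) • Q = toGeomPoints (W.baseChange K) R →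
      ∃ R' : (W.baseChange K).toAffine.Point, (2 : ℤ) • R' = R) :
    ∃ (n : ℕ) (d : KolyvaginHeegnerData Dt β ι n), Squarefree n ∧
      (∀ ℓ ∈ n.primeFactors, Zhang2014.IsKolyvaginPrime (W.conductorNorm ℤ) W K 2 ℓ ∧ 2 ≤ Zhang2014.kolyvaginIndex W 2 ℓ ∧
        FrobEqFrobInfty W K 2 ℓ) ∧
      ¬ ∃ Q : (W.baseChange (ringClassField K ι n)).toAffine.Point, (2 : ℤ) • Q = d.derivedPoint := by
  have hBW : BSDp W 2 := Census.bsdp_rankZero_of_wallRows hOrd hMult hSS hAdd W hcm hr0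
  have hcmd : ¬ Wd.HasCM := by
    obtain ⟨C, hC⟩ := hWd
    have hd : (NumberField.discr K : ℚ) ≠ 0 := Int.cast_ne_zero.mpr (NumberField.discr_ne_zero K)
    haveI := W.isElliptic_quadraticTwist hd
    rw [← hC]
    exact not_hasCM_variableChange _ C (not_hasCM_quadraticTwist W hd hcm)
  have hBd : BSDp Wd 2 := hTw Wd hcmd hrd hSel
  exact kFourNeg_conclusion_of_bsdp_pair_of_halvingBit hQ2 hGZ hGZK hL hMi W hcm hr0 hρ hT hneg K hIQ hodd h3 hHe hsq1 hsq2 Dt hc β ι d₁ hy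
    M₀ hdiv hndiv hM₀ Wd hWd hrd hSel hDEF hBW hBd hHalf

end Summit.BirchSwinnertonDyer.BirchSwinnertonDyer.Theorems.GenusExact.PlusDescent

end
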